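import Summits.AtomisticToContinuum.FouriersLaw.Theorems.OddSectorIrreversibilityWitnessGlueClosedFlow
import Summits.AtomisticToContinuum.FouriersLaw.Theorems.OddSectorIrreversibilityOddCorrectorDecayClosedFlow
import Summits.AtomisticToContinuum.FouriersLaw.Theorems.SubBallisticWindow.Negative.ClosedFlow
import Literature.MathematicalPhysics.KineticTheory.PhaseSpacePoisson
import Literature.Analysis.Complex.CarlemanDichotomy

/-!
# `SubBallisticWindow` (stmt-AtomisticToContinuum-14070), line `Sketch`: the coboundary (Thomson) ceiling

Support file for crux `Summit.AtomisticToContinuum.FouriersLaw.Theses.OddSectorIrreversibility.SubBallisticWindow`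
(E2 of route OddSectorIrreversibility), registered stub `stub_coboundaryCeiling` of the line skeleton.

For the CLOSED pinned chain (Hamiltonian flow `Φ_t = detFlow`, Gibbs weight `μ_T = e^{-H/T} dq dp`,
which is `Φ_t`-invariant — Liouville, `ClosedChainFlow.measurePreserving_closedChainFlow_gibbsWeight`),
every test observable `G ∈ C²` with `G, {H,G} ∈ L²(μ_T)` and every constant `c` give the ceiling
`∫ (∫_{(0,τ]} J_B(Φ_t x) dt)² dμ_T ≤ 8 ∫ (G - c)² dμ_T + 2 τ² ∫ (J_B - {H,G})² dμ_T`
for the windowed block current `J_B = ∑_{k₁ ≤ i < k₂} j_i`. Route: the coboundary decomposition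
`∫_{(0,τ]} J_B∘Φ_t = (G∘Φ_τ - G) + ∫_{(0,τ]} (J_B - {H,G})∘Φ_t` (FTC along the flow,
`SubBallisticWindow.Negative.ClosedFlow.comp_closedFlow_sub_eq_integral`), `(a+b)² ≤ 2a² + 2b²`,
invariance of `μ_T` under `Φ_τ`, Cauchy–Schwarz in `t`, Tonelli and invariance at each `t ∈ (0,τ]`.
-/

noncomputable section

namespace Summit.AtomisticToContinuum.FouriersLaw.Theorems.SubBallisticWindow.CoboundaryCeiling

open MeasureTheory Filter Topology Set
open scoped NNReal ENNReal ContDiff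
open Literature.MathematicalPhysics.KineticTheory.HeatConduction
open Summit.AtomisticToContinuum.FouriersLaw.Theorems.ClosedConeSensitivity.Negative.ZeroFrictionDictionary
open Summit.AtomisticToContinuum.FouriersLaw.Theorems.OddSectorWitness
open Summit.AtomisticToContinuum.FouriersLaw.Theorems.ClosedChainFlow
open Summit.AtomisticToContinuum.FouriersLaw.Theorems.SubBallisticWindow.Negative.ClosedFlow

/-! ## Cauchy–Schwarz in time -/

/-- Cauchy–Schwarz on the window `(0, τ]`: `(∫_{(0,τ]} f)² ≤ τ ∫_{(0,τ]} f²` for continuous `f`,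
`τ ≥ 0` (the tree's interval-integral version `CarlemanTract.sq_integral_le_mul_integral_sq`, read on
`Ioc 0 τ`). [folklore] -/
theorem sq_setIntegral_Ioc_le {f : ℝ → ℝ} {τ : ℝ} (hτ : 0 ≤ τ) (hf : Continuous f) :
    (∫ t in Ioc (0 : ℝ) τ, f t) ^ 2 ≤ τ * ∫ t in Ioc (0 : ℝ) τ, f t ^ 2 := by
  have h := Literature.Analysis.Complex.CarlemanTract.sq_integral_le_mul_integral_sq hτ hf
  rwa [intervalIntegral.integral_of_le hτ, intervalIntegral.integral_of_le hτ, sub_zero] at h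

variable {ω₂ lam β : ℝ} (hω : 0 < ω₂) (hl : 0 ≤ lam) (hβ : 0 ≤ β)
include hω hl hβ

/-! ## Liouville for `detFlow` on the Gibbs weight, all `N` -/

/-- The closed flow `Φ_t = detFlow` (`t ≥ 0`) preserves the Gibbs weight `e^{-H/T} dq dp`, for every
`N` (for `N = 0` the phase space is a point). [folklore] -/
theorem measurePreserving_detFlow_gibbsWeight (γ : ℝ) (N : ℕ) (T : ℝ) {t : ℝ} (ht : 0 ≤ t) :
    MeasurePreserving (detFlow ω₂ lam β N t) (gibbsWeight ω₂ lam β γ N T) (gibbsWeight ω₂ lam β γ N T) := by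
  rcases Nat.eq_zero_or_pos N with rfl | hN
  · have h : detFlow ω₂ lam β 0 t = id := funext fun x => Subsingleton.elim _ _
    rw [h]
    exact MeasurePreserving.id _
  · exact measurePreserving_closedChainFlow_gibbsWeight hω hl hβ hN γ T ht

/-- Change of variables along the closed flow: `∫ g(Φ_t x) dμ_T = ∫ g dμ_T` (`t ≥ 0`). [folklore] -/
theorem integral_comp_detFlow_gibbsWeight (γ : ℝ) (N : ℕ) (T : ℝ) {t : ℝ} (ht : 0 ≤ t)
    {g : PhaseSpace N → ℝ} (hg : AEStronglyMeasurable g (gibbsWeight ω₂ lam β γ N T)) :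
    ∫ x, g (detFlow ω₂ lam β N t x) ∂(gibbsWeight ω₂ lam β γ N T) =
      ∫ x, g x ∂(gibbsWeight ω₂ lam β γ N T) := by
  have hΦ := measurePreserving_detFlow_gibbsWeight hω hl hβ γ N T ht
  have hg' : AEStronglyMeasurable g (Measure.map (detFlow ω₂ lam β N t) (gibbsWeight ω₂ lam β γ N T)) := by
    rw [hΦ.map_eq]; exact hg
  rw [← integral_map hΦ.measurable.aemeasurable hg', hΦ.map_eq]

/-- Transport of integrability along the closed flow: `g ∈ L¹(μ_T) ⇒ g∘Φ_t ∈ L¹(μ_T)`. [folklore] -/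
theorem integrable_comp_detFlow_gibbsWeight (γ : ℝ) (N : ℕ) (T : ℝ) {t : ℝ} (ht : 0 ≤ t)
    {g : PhaseSpace N → ℝ} (hg : Integrable g (gibbsWeight ω₂ lam β γ N T)) :
    Integrable (fun x => g (detFlow ω₂ lam β N t x)) (gibbsWeight ω₂ lam β γ N T) :=
  (measurePreserving_detFlow_gibbsWeight hω hl hβ γ N T ht).integrable_comp_of_integrable hg

/-! ## Tonelli + Liouville for the transported square of an `L²` observable -/

/-- For a continuous `R ∈ L²(μ_T)` and `τ ≥ 0`: `x ↦ ∫_{(0,τ]} R(Φ_t x)² dt` is `μ_T`-integrable and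
`∫ ∫_{(0,τ]} R(Φ_t x)² dt dμ_T = τ ∫ R² dμ_T` (Tonelli, and invariance of `μ_T` at each `t`). [folklore] -/
theorem integral_setIntegral_sq_comp_detFlow (γ : ℝ) (N : ℕ) {T : ℝ} (hT : 0 < T) {τ : ℝ} (hτ : 0 ≤ τ)
    {R : PhaseSpace N → ℝ} (hRc : Continuous R) (hR : MemLp R 2 (gibbsWeight ω₂ lam β γ N T)) :
    Integrable (fun x => ∫ t in Ioc (0 : ℝ) τ, (R (detFlow ω₂ lam β N t x)) ^ 2) (gibbsWeight ω₂ lam β γ N T) ∧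
    ∫ x, (∫ t in Ioc (0 : ℝ) τ, (R (detFlow ω₂ lam β N t x)) ^ 2) ∂(gibbsWeight ω₂ lam β γ N T) =
      τ * ∫ x, (R x) ^ 2 ∂(gibbsWeight ω₂ lam β γ N T) := by
  haveI := isFiniteMeasure_gibbsWeight hω hl hβ γ N hT
  have hR2 : Integrable (fun x => (R x) ^ 2) (gibbsWeight ω₂ lam β γ N T) :=
    (memLp_two_iff_integrable_sq hR.1).1 hR
  have hFm : Measurable fun p : ℝ × PhaseSpace N => (R (detFlow ω₂ lam β N p.1 p.2)) ^ 2 :=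
    (hRc.measurable.comp (measurable_detFlow_uncurry hω hl hβ N)).pow_const 2
  have hslice : ∀ t : ℝ, 0 ≤ t →
      Integrable (fun x => (R (detFlow ω₂ lam β N t x)) ^ 2) (gibbsWeight ω₂ lam β γ N T) ∧
      ∫ x, (R (detFlow ω₂ lam β N t x)) ^ 2 ∂(gibbsWeight ω₂ lam β γ N T) =
        ∫ x, (R x) ^ 2 ∂(gibbsWeight ω₂ lam β γ N T) := fun t ht =>
    ⟨integrable_comp_detFlow_gibbsWeight hω hl hβ γ N T ht (g := fun x => (R x) ^ 2) hR2,
      integral_comp_detFlow_gibbsWeight hω hl hβ γ N T ht (g := fun x => (R x) ^ 2)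
        hR2.aestronglyMeasurable⟩
  have hInt : Integrable (fun p : ℝ × PhaseSpace N => (R (detFlow ω₂ lam β N p.1 p.2)) ^ 2)
      ((volume.restrict (Ioc (0 : ℝ) τ)).prod (gibbsWeight ω₂ lam β γ N T)) := by
    rw [integrable_prod_iff hFm.aestronglyMeasurable]
    refine ⟨(ae_restrict_iff' measurableSet_Ioc).2 (Eventually.of_forall fun t ht => (hslice t ht.1.le).1), ?_⟩
    have hae : (fun t => ∫ x, ‖(R (detFlow ω₂ lam β N t x)) ^ 2‖ ∂(gibbsWeight ω₂ lam β γ N T))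
        =ᵐ[volume.restrict (Ioc (0 : ℝ) τ)] fun _ => ∫ x, (R x) ^ 2 ∂(gibbsWeight ω₂ lam β γ N T) := by
      refine (ae_restrict_iff' measurableSet_Ioc).2 (Eventually.of_forall fun t ht => ?_)
      rw [← (hslice t ht.1.le).2]
      refine integral_congr_ae (Eventually.of_forall fun x => ?_)
      simp only [Real.norm_eq_abs, abs_pow, sq_abs]
    exact (integrable_const _).congr hae.symm
  refine ⟨hInt.integral_prod_right, ?_⟩
  rw [← integral_integral_swap (f := fun t x => (R (detFlow ω₂ lam β N t x)) ^ 2) hInt,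
    setIntegral_congr_fun measurableSet_Ioc (fun t ht => (hslice t ht.1.le).2), setIntegral_const,
    Real.volume_real_Ioc_of_le hτ, sub_zero, smul_eq_mul]

/-! ## The coboundary decomposition and the ceiling -/

/-- **Coboundary decomposition** of a transported window: for `G ∈ C²`, `τ ≥ 0` and a continuous
observable `J`,
`∫_{(0,τ]} J(Φ_t x) dt = (G(Φ_τ x) - G(x)) + ∫_{(0,τ]} (J - {H,G})(Φ_t x) dt`
(FTC along the closed flow: `d/dt G(Φ_t x) = {H,G}(Φ_t x)`). [folklore] -/
theorem setIntegral_comp_detFlow_eq_coboundary_add (γ : ℝ) (N : ℕ) {τ : ℝ} (hτ : 0 ≤ τ)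
    {J : PhaseSpace N → ℝ} (hJ : Continuous J) {G : PhaseSpace N → ℝ} (hG : ContDiff ℝ 2 G)
    (x : PhaseSpace N) :
    ∫ t in Ioc (0 : ℝ) τ, J (detFlow ω₂ lam β N t x) =
      (G (detFlow ω₂ lam β N τ x) - G x) +
        ∫ t in Ioc (0 : ℝ) τ, (J (detFlow ω₂ lam β N t x) -
          poisson ((pinnedChain ω₂ lam β γ).hamiltonian N) G (detFlow ω₂ lam β N t x)) := by
  have hHc : ContDiff ℝ 2 ((pinnedChain ω₂ lam β γ).hamiltonian N) :=
    pinnedChain_contDiff_hamiltonian ω₂ lam β γ N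
  have hPc : Continuous (poisson ((pinnedChain ω₂ lam β γ).hamiltonian N) G) :=
    (differentiable_poisson hHc hG).continuous
  have hΦc : Continuous fun t => detFlow ω₂ lam β N t x := continuous_detFlow_time hω hl hβ N x
  have hJi : IntegrableOn (fun t => J (detFlow ω₂ lam β N t x)) (Ioc (0 : ℝ) τ) :=
    (hJ.comp hΦc).integrableOn_Ioc
  have hPi : IntegrableOn (fun t => poisson ((pinnedChain ω₂ lam β γ).hamiltonian N) G
      (detFlow ω₂ lam β N t x)) (Ioc (0 : ℝ) τ) :=
    (hPc.comp hΦc).integrableOn_Ioc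
  -- FTC along the flow (`detFlow = closedFlow`, `H_γ = H_0`, both `rfl`)
  have hftc : ∫ t in Ioc (0 : ℝ) τ, poisson ((pinnedChain ω₂ lam β γ).hamiltonian N) G
      (detFlow ω₂ lam β N t x) = G (detFlow ω₂ lam β N τ x) - G x := by
    rw [← intervalIntegral.integral_of_le hτ]
    exact (comp_closedFlow_sub_eq_integral hω hl hβ N hG x hτ).symm
  rw [integral_sub hJi hPi, hftc]
  ring

/-- **The coboundary (Thomson) ceiling**, abstract form: for a continuous observable `J ∈ L²(μ_T)`,
a test observable `G ∈ C²` with `G, {H,G} ∈ L²(μ_T)`, a constant `c` and `τ ≥ 0`,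
`∫ (∫_{(0,τ]} J(Φ_t x) dt)² dμ_T ≤ 8 ∫ (G - c)² dμ_T + 2 τ² ∫ (J - {H,G})² dμ_T`. [folklore] -/
theorem integral_sq_setIntegral_comp_detFlow_le (γ : ℝ) (N : ℕ) {T : ℝ} (hT : 0 < T) {τ : ℝ} (hτ : 0 ≤ τ)
    {J : PhaseSpace N → ℝ} (hJ : Continuous J) (hJL : MemLp J 2 (gibbsWeight ω₂ lam β γ N T))
    {G : PhaseSpace N → ℝ} (c : ℝ) (hG : ContDiff ℝ 2 G) (hGL : MemLp G 2 (gibbsWeight ω₂ lam β γ N T))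
    (hPG : MemLp (poisson ((pinnedChain ω₂ lam β γ).hamiltonian N) G) 2 (gibbsWeight ω₂ lam β γ N T)) :
    ∫ x, (∫ t in Ioc (0 : ℝ) τ, J (detFlow ω₂ lam β N t x)) ^ 2 ∂(gibbsWeight ω₂ lam β γ N T) ≤
      8 * ∫ x, (G x - c) ^ 2 ∂(gibbsWeight ω₂ lam β γ N T) +
        2 * τ ^ 2 * ∫ x, (J x - poisson ((pinnedChain ω₂ lam β γ).hamiltonian N) G x) ^ 2
          ∂(gibbsWeight ω₂ lam β γ N T) := by
  haveI := isFiniteMeasure_gibbsWeight hω hl hβ γ N hT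
  have hHc : ContDiff ℝ 2 ((pinnedChain ω₂ lam β γ).hamiltonian N) :=
    pinnedChain_contDiff_hamiltonian ω₂ lam β γ N
  have hGc : Continuous G := hG.continuous
  have hPc : Continuous (poisson ((pinnedChain ω₂ lam β γ).hamiltonian N) G) :=
    (differentiable_poisson hHc hG).continuous
  have hRc : Continuous fun z => J z - poisson ((pinnedChain ω₂ lam β γ).hamiltonian N) G z :=
    hJ.sub hPc
  have hRL : MemLp (fun z => J z - poisson ((pinnedChain ω₂ lam β γ).hamiltonian N) G z) 2
      (gibbsWeight ω₂ lam β γ N T) := hJL.sub hPG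
  have hGcL : MemLp (fun x => G x - c) 2 (gibbsWeight ω₂ lam β γ N T) := hGL.sub (memLp_const c)
  have hb : Integrable (fun x => (G x - c) ^ 2) (gibbsWeight ω₂ lam β γ N T) :=
    (memLp_two_iff_integrable_sq hGcL.1).1 hGcL
  -- Liouville at time `τ`
  have ha : Integrable (fun x => (G (detFlow ω₂ lam β N τ x) - c) ^ 2) (gibbsWeight ω₂ lam β γ N T) :=
    integrable_comp_detFlow_gibbsWeight hω hl hβ γ N T hτ (g := fun x => (G x - c) ^ 2) hb
  have ha_eq : ∫ x, (G (detFlow ω₂ lam β N τ x) - c) ^ 2 ∂(gibbsWeight ω₂ lam β γ N T) =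
      ∫ x, (G x - c) ^ 2 ∂(gibbsWeight ω₂ lam β γ N T) :=
    integral_comp_detFlow_gibbsWeight hω hl hβ γ N T hτ (g := fun x => (G x - c) ^ 2) hb.aestronglyMeasurable
  -- Tonelli + Liouville for the defect `R = J - {H,G}`
  obtain ⟨hS, hS_eq⟩ := integral_setIntegral_sq_comp_detFlow hω hl hβ γ N hT hτ hRc hRL
  -- the pointwise bound
  have hpt : ∀ x, (∫ t in Ioc (0 : ℝ) τ, J (detFlow ω₂ lam β N t x)) ^ 2 ≤
      4 * (G (detFlow ω₂ lam β N τ x) - c) ^ 2 + 4 * (G x - c) ^ 2 +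
        2 * τ * ∫ t in Ioc (0 : ℝ) τ, (J (detFlow ω₂ lam β N t x) -
          poisson ((pinnedChain ω₂ lam β γ).hamiltonian N) G (detFlow ω₂ lam β N t x)) ^ 2 := by
    intro x
    rw [setIntegral_comp_detFlow_eq_coboundary_add hω hl hβ γ N hτ hJ hG x]
    have hcont : Continuous fun t => J (detFlow ω₂ lam β N t x) -
        poisson ((pinnedChain ω₂ lam β γ).hamiltonian N) G (detFlow ω₂ lam β N t x) :=
      hRc.comp (continuous_detFlow_time hω hl hβ N x)
    have hCS := sq_setIntegral_Ioc_le hτ hcont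
    nlinarith [hCS, sq_nonneg ((∫ t in Ioc (0 : ℝ) τ, (J (detFlow ω₂ lam β N t x) -
          poisson ((pinnedChain ω₂ lam β γ).hamiltonian N) G (detFlow ω₂ lam β N t x))) -
        (G (detFlow ω₂ lam β N τ x) - c) + (G x - c)),
      sq_nonneg ((G (detFlow ω₂ lam β N τ x) - c) + (G x - c))]
  -- integrate
  have hI1 : Integrable (fun x => 4 * (G (detFlow ω₂ lam β N τ x) - c) ^ 2 + 4 * (G x - c) ^ 2)
      (gibbsWeight ω₂ lam β γ N T) := (ha.const_mul 4).add (hb.const_mul 4)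
  have hI2 : Integrable (fun x => 2 * τ * ∫ t in Ioc (0 : ℝ) τ, (J (detFlow ω₂ lam β N t x) -
      poisson ((pinnedChain ω₂ lam β γ).hamiltonian N) G (detFlow ω₂ lam β N t x)) ^ 2)
      (gibbsWeight ω₂ lam β γ N T) := hS.const_mul (2 * τ)
  have h0 : 0 ≤ᵐ[gibbsWeight ω₂ lam β γ N T] fun x => (∫ t in Ioc (0 : ℝ) τ, J (detFlow ω₂ lam β N t x)) ^ 2 :=
    Eventually.of_forall fun x => sq_nonneg _
  have hI : Integrable (fun x => 4 * (G (detFlow ω₂ lam β N τ x) - c) ^ 2 + 4 * (G x - c) ^ 2 +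
      2 * τ * ∫ t in Ioc (0 : ℝ) τ, (J (detFlow ω₂ lam β N t x) -
        poisson ((pinnedChain ω₂ lam β γ).hamiltonian N) G (detFlow ω₂ lam β N t x)) ^ 2)
      (gibbsWeight ω₂ lam β γ N T) := hI1.add hI2
  have hle : (fun x => (∫ t in Ioc (0 : ℝ) τ, J (detFlow ω₂ lam β N t x)) ^ 2) ≤ᵐ[gibbsWeight ω₂ lam β γ N T]
      (fun x => 4 * (G (detFlow ω₂ lam β N τ x) - c) ^ 2 + 4 * (G x - c) ^ 2 +
        2 * τ * ∫ t in Ioc (0 : ℝ) τ, (J (detFlow ω₂ lam β N t x) -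
          poisson ((pinnedChain ω₂ lam β γ).hamiltonian N) G (detFlow ω₂ lam β N t x)) ^ 2) :=
    Eventually.of_forall hpt
  have hmono := integral_mono_of_nonneg h0 hI hle
  have hsplit : ∫ x, (4 * (G (detFlow ω₂ lam β N τ x) - c) ^ 2 + 4 * (G x - c) ^ 2 +
      2 * τ * ∫ t in Ioc (0 : ℝ) τ, (J (detFlow ω₂ lam β N t x) -
        poisson ((pinnedChain ω₂ lam β γ).hamiltonian N) G (detFlow ω₂ lam β N t x)) ^ 2)
      ∂(gibbsWeight ω₂ lam β γ N T) =
      4 * ∫ x, (G (detFlow ω₂ lam β N τ x) - c) ^ 2 ∂(gibbsWeight ω₂ lam β γ N T) +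
        4 * ∫ x, (G x - c) ^ 2 ∂(gibbsWeight ω₂ lam β γ N T) +
        2 * τ * ∫ x, (∫ t in Ioc (0 : ℝ) τ, (J (detFlow ω₂ lam β N t x) -
          poisson ((pinnedChain ω₂ lam β γ).hamiltonian N) G (detFlow ω₂ lam β N t x)) ^ 2)
          ∂(gibbsWeight ω₂ lam β γ N T) := by
    rw [integral_add hI1 hI2, integral_add (ha.const_mul 4) (hb.const_mul 4), integral_const_mul,
      integral_const_mul, integral_const_mul]
  rw [hsplit, ha_eq, hS_eq] at hmono
  calc _ ≤ _ := hmono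
    _ = _ := by ring

/-- The block current `J_{[k₁,k₂)}` is square integrable against the Gibbs weight
(`|J_B| ≤ N² (3+β)/2 (1+H)²`). [folklore] -/
theorem memLp_two_blockCurrent (γ : ℝ) (N k₁ k₂ : ℕ) {T : ℝ} (hT : 0 < T) :
    MemLp (blockCurrent ω₂ lam β γ N k₁ k₂) 2 (gibbsWeight ω₂ lam β γ N T) :=
  memLp_two_of_abs_le_pow hω hl hβ γ N hT (continuous_blockCurrent N γ k₁ k₂).aestronglyMeasurable
    (N * (N * ((3 + β) / 2))) 2 fun z => by
      have h := abs_blockCurrent_detFlow_le hω hl hβ N γ k₁ k₂ 0 z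
      rw [detFlow_of_nonpos N le_rfl] at h
      calc _ ≤ _ := h
        _ = _ := by ring

/-- **The coboundary ceiling for the block current** (`window`/`gibbsWeight` vocabulary):
`∫ Q_B(τ)² dμ_T ≤ 8 ∫ (G - c)² dμ_T + 2 τ² ∫ (J_B - {H,G})² dμ_T`. [folklore] -/
theorem integral_window_sq_le (γ : ℝ) (N k₁ k₂ : ℕ) {T : ℝ} (hT : 0 < T) {τ : ℝ} (hτ : 0 ≤ τ)
    {G : PhaseSpace N → ℝ} (c : ℝ) (hG : ContDiff ℝ 2 G) (hGL : MemLp G 2 (gibbsWeight ω₂ lam β γ N T))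
    (hPG : MemLp (poisson ((pinnedChain ω₂ lam β γ).hamiltonian N) G) 2 (gibbsWeight ω₂ lam β γ N T)) :
    ∫ x, (window ω₂ lam β γ N k₁ k₂ τ x) ^ 2 ∂(gibbsWeight ω₂ lam β γ N T) ≤
      8 * ∫ x, (G x - c) ^ 2 ∂(gibbsWeight ω₂ lam β γ N T) +
        2 * τ ^ 2 * ∫ x, (blockCurrent ω₂ lam β γ N k₁ k₂ x -
          poisson ((pinnedChain ω₂ lam β γ).hamiltonian N) G x) ^ 2 ∂(gibbsWeight ω₂ lam β γ N T) :=
  integral_sq_setIntegral_comp_detFlow_le hω hl hβ γ N hT hτ (continuous_blockCurrent N γ k₁ k₂)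
    (memLp_two_blockCurrent hω hl hβ γ N k₁ k₂ hT) c hG hGL hPG

omit hω hl hβ in
/-- **stub_coboundaryCeiling** (Thomson inequality for the closed flow; FIXED `N`).
For `ω₂ > 0`, `lam, β ≥ 0`, any `γ`, `T > 0`, every `N`, block `[k₁,k₂)`, window `τ ≥ 0`, every test
observable `G ∈ C²` with `G, {H,G} ∈ L²(μ)` and every constant `c`:
`∫ Q_B(τ)² dμ ≤ 8 ∫ (G − c)² dμ + 2 τ² ∫ (J_B − {H,G})² dμ`, `Q_B(τ)(x) = ∫_{(0,τ]} J_B(Φ_t x) dt`,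
`Φ_t = detFlow` the closed Hamiltonian flow, `μ = e^{-H/T} dq dp`. Proof: the coboundary decomposition
`Q_B(τ)(x) = (G(Φ_τ x) − G(x)) + ∫_{(0,τ]} (J_B − {H,G})(Φ_t x) dt` (FTC along the flow),
`(a+b)² ≤ 2a² + 2b²`, Liouville invariance of `μ`, Cauchy–Schwarz in `t` and Tonelli. [folklore] -/
theorem stub_coboundaryCeiling :
    ∀ ω₂ lam β γ : ℝ, 0 < ω₂ → 0 ≤ lam → 0 ≤ β → ∀ T : ℝ, 0 < T →
    ∀ (N k₁ k₂ : ℕ) (τ : ℝ), 0 ≤ τ → ∀ (G : PhaseSpace N → ℝ) (c : ℝ), ContDiff ℝ 2 G →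
      MemLp G 2 (volume.withDensity fun x : PhaseSpace N => ENNReal.ofReal (Real.exp (-((pinnedChain ω₂ lam β γ).hamiltonian N x) / T))) →
      MemLp (poisson ((pinnedChain ω₂ lam β γ).hamiltonian N) G) 2
        (volume.withDensity fun x : PhaseSpace N => ENNReal.ofReal (Real.exp (-((pinnedChain ω₂ lam β γ).hamiltonian N x) / T))) →
      ∫ x, (∫ t in Set.Ioc (0 : ℝ) τ,
          (fun z : PhaseSpace N => ∑ i : Fin N, (if k₁ ≤ i.val ∧ i.val < k₂ then (pinnedChain ω₂ lam β γ).bondCurrent N i z else 0))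
            (detFlow ω₂ lam β N t x)) ^ 2
        ∂(volume.withDensity fun x : PhaseSpace N => ENNReal.ofReal (Real.exp (-((pinnedChain ω₂ lam β γ).hamiltonian N x) / T))) ≤
        8 * ∫ x, (G x - c) ^ 2
          ∂(volume.withDensity fun x : PhaseSpace N => ENNReal.ofReal (Real.exp (-((pinnedChain ω₂ lam β γ).hamiltonian N x) / T))) +
        2 * τ ^ 2 * ∫ x,
          ((fun z : PhaseSpace N => ∑ i : Fin N, (if k₁ ≤ i.val ∧ i.val < k₂ then (pinnedChain ω₂ lam β γ).bondCurrent N i z else 0)) x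
            - poisson ((pinnedChain ω₂ lam β γ).hamiltonian N) G x) ^ 2
          ∂(volume.withDensity fun x : PhaseSpace N => ENNReal.ofReal (Real.exp (-((pinnedChain ω₂ lam β γ).hamiltonian N x) / T))) := by
  intro ω₂ lam β γ hω hl hβ T hT N k₁ k₂ τ hτ G c hG hGL hPG
  exact integral_window_sq_le hω hl hβ γ N k₁ k₂ hT hτ c hG hGL hPG

end Summit.AtomisticToContinuum.FouriersLaw.Theorems.SubBallisticWindow.CoboundaryCeiling

end
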